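import Summits.QuantumFields.YangMills.Theorems.InfiniteVolumeTorusApproximation
import Literature.MathematicalPhysics.QuantumFieldTheory.SchwingerLimitInheritance
import Summits.QuantumFields.YangMills.Theorems.LangevinControlUVOSLegsFromFemtoAndGapStubAssemblyCompactness
import HarnessLib

/-!
# Infinite volume by compactness, step 6: the «`L → ∞` first» functionals are asymptotic to the spine's torus
# distributions along a torus species scheme with sides above any growth demand (the (A)↔(B) junction)

HONEST FRAMING (cell `ym-fleet`, seat `ym-infvol-p2`, director-ym R136 (i) «INFINITE-VOLUME ∕ CONTINUUM-FROM-UV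
ROUTE», pre-birth helper; bears on LADDER-YM R1∕R2a).  Pure soft analysis, kernel-checked; NOTHING here is a
statement about Bałaban's renormalisation group, the OS axioms, uniqueness of the infinite-volume state, a mass gap,
or Clay.  The only Yang–Mills-specific input type is the spine's UV-leg currency `MomentBounds6 G r a` (HYPOTHESIS),
used for the two a-uniform bounds on `⁰𝒮ₙ` (torus side: the spine's `norm_latticeSumStr_plane_le`; infinite-volume
side: step 2).

WHY.  The spine's legs (`ROT`'s `LatticeRotWard`, the RP ∕ hypercubic toolkits of `OSLegsFromFemtoAndGap`) are
statements about the TORUS plane-string distributions `latticeDistStr r.ρ β_k L_k a_k …` along species schemes whose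
torus sides may be required to exceed any growth demand.  The infinite-volume route reads, at level `k`, the series
`F ↦ Σ'ₓ W_{μ_k}(q,x)·F(a_k·x)` of a thermodynamic limit state `μ_k ∈ oddTorusLimitPoints r β_k`.  THIS FILE: for any
such data and ANY growth demand `g` there are torus sides `L_k ≥ g k` (with `L_k ≥ 14`, `L_k ≥ a_k⁻²`, and `2L_k+1`
one of `μ_k`'s own approximating tori) such that, for every `n ≥ 2`, valid string `q` and `F ∈ ⁰𝒮ₙ`,
`latticeDistStr(β_k, L_k, a_k)(q)(F) − Σ'ₓ W_{μ_k}(q,x)·F(a_k·x) → 0`.  Hence every subsequential limit of the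
infinite-volume functionals (step 3) IS the limit of the spine's torus distributions along the species scheme
`(β_k, L_k, a_k)`, and conversely — torus-scheme theorems transfer to the «`L → ∞` first» continuum data.
Mechanism: step 5 (Tannery, per test function) + diagonal selection over a countable `‖·‖_{10n}`-dense subset of each
`⁰𝒮ₙ` (the spine's `schwartz_exists_countable_seminorm_dense`) + equicontinuity from the two a-uniform bounds.

WHAT IS PROVED ([folklore] throughout).
* §1 `norm_latticeDistStr_le_of_momentBounds6` (the spine's torus a-uniform bound in `schwartzNorm` form),
  `tsum_sub_eq` (linearity of the infinite-volume series on `𝓢`).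
* §2 **`exists_torusSides_approximating`** — THE JUNCTION THEOREM stated above (thresholds `β₀`, `ℓ₀ > 0` from
  `MomentBounds6`; for every admissible coupling sequence, every choice of odd-torus limit states, every growth
  demand).

References: Glimm–Jaffe (1987) §6.1; Osterwalder–Schrader CMP 42 (1975) §2; Chatterjee arXiv:1803.01950 §2.
-/

set_option autoImplicit false

noncomputable section

open scoped BigOperators SchwartzMap
open MeasureTheory Filter Topology
open Literature.MathematicalPhysics.QuantumFieldTheory hiding ZdEdge
open Literature.MathematicalPhysics.QuantumLattice
open Literature.MathematicalPhysics.AQFT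
open Literature.Probability.LatticeModels (box Site)
open Summit.QuantumFields.YangMills.Cruxes.OSLegsFromFemtoAndGap.DlrCollarTransfer
  (plane torusE MomentBounds6 exists_abs_plane_le)
open Summit.QuantumFields.YangMills.Theorems.OSLegsFromFemtoAndGap
  (torusMomentStr latticeDistStr latticeDistStr_apply norm_latticeSumStr_plane_le seminorm_budget_le_schwartzNorm
    schwartz_exists_countable_seminorm_dense)

namespace Summit.QuantumFields.YangMills.Theorems.InfiniteVolume

variable {G : Type} [Group G] [TopologicalSpace G] [IsTopologicalGroup G] [CompactSpace G]
  [MeasurableSpace G] [BorelSpace G]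

/-! ## §1 The two a-uniform bounds and linearity of the series -/

/-- **The spine's torus a-uniform bound in `schwartzNorm` form**: from `MomentBounds6 G r a`, thresholds `β₄`, `ℓ₄`
and `K` with `‖latticeDistStr r.ρ β L (a β) (planes q) (means) F‖ ≤ 5Kⁿ·‖F‖_{10n}` for `β ≥ β₄`,
`0 < a β ≤ min (1/24) ℓ₄`, `L ≥ 14`, `L ≥ (a β)⁻²`, `n ≥ 2`, valid `q`, `F ∈ ⁰𝒮ₙ`. [folklore] -/
theorem norm_latticeDistStr_le_of_momentBounds6 (r : LatticeRep G) {a : ℝ → ℝ} (hMB : MomentBounds6 G r a) :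
    ∃ (β₄ ℓ₄ K : ℝ), 0 < ℓ₄ ∧ 0 ≤ K ∧ ∀ β : ℝ, β₄ ≤ β → 0 < a β → a β ≤ 1 / 24 → a β ≤ ℓ₄ →
      ∀ L : ℕ, 14 ≤ L → (a β)⁻¹ * (a β)⁻¹ ≤ L →
      ∀ n : ℕ, 2 ≤ n → ∀ q : Fin n → Fin 4 × Fin 4, (∀ i, (q i).1 < (q i).2) →
      ∀ F : 𝓢((Fin n → EuclideanSpace ℝ (Fin 4)), ℂ), IsOffDiagonal F →
        ‖latticeDistStr r.ρ β L (a β) (fun i U => plaquetteObs r.ρ 0 (q i).1 (q i).2 U)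
          (fun i => wilsonTorusMean r.ρ β L (fun U => plaquetteObs r.ρ 0 (q i).1 (q i).2 U)) F‖ ≤
          5 * K ^ n * schwartzNorm (10 * n) F := by
  obtain ⟨β₄, ℓ₄, K, hℓ, hK, H⟩ := norm_latticeSumStr_plane_le r hMB
  refine ⟨β₄, ℓ₄, K, hℓ, hK, fun β hβ ha ha24 haℓ L hL14 hLa n hn q hq F hF => ?_⟩
  rw [latticeDistStr_apply]
  calc _ ≤ K ^ n * (SchwartzMap.seminorm ℂ 0 (4 * n) F + SchwartzMap.seminorm ℂ (6 * n) (4 * n) F +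
        SchwartzMap.seminorm ℂ 0 0 F + SchwartzMap.seminorm ℂ (6 * n) 0 F + SchwartzMap.seminorm ℂ (10 * n) 0 F) :=
        H β hβ ha ha24 haℓ L hL14 hLa n hn q hq F hF (fun x l => a β • siteToE (x l)) (fun x l => by
          rw [sub_self, norm_zero]; positivity)
    _ ≤ K ^ n * (5 * schwartzNorm (10 * n) F) := by gcongr; exact seminorm_budget_le_schwartzNorm n F
    _ = _ := by ring

/-- Linearity of the infinite-volume series in the test function (bounded weights). [folklore] -/
theorem tsum_weight_mul_sub {n : ℕ} {a s B : ℝ} (ha : 0 < a) (ha1 : a ≤ 1) (hsa : s * a ≤ 1 / 4) (hB : 0 ≤ B)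
    (W : (Fin n → Site 4) → ℝ) (hW : ∀ x, |W x| ≤ B)
    (y : (Fin n → Site 4) → (Fin n → EuclideanSpace ℝ (Fin 4))) (hyx : ∀ x l, ‖y x l - a • siteToE (x l)‖ ≤ s * a)
    (F F' : 𝓢((Fin n → EuclideanSpace ℝ (Fin 4)), ℂ)) :
    ∑' x : Fin n → Site 4, ((W x : ℝ) : ℂ) * (F - F') (y x) =
      ∑' x : Fin n → Site 4, ((W x : ℝ) : ℂ) * F (y x) - ∑' x : Fin n → Site 4, ((W x : ℝ) : ℂ) * F' (y x) := by
  rw [← Summable.tsum_sub (summable_mul_of_bounded ha ha1 hsa hB W hW F y hyx)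
    (summable_mul_of_bounded ha ha1 hsa hB W hW F' y hyx)]
  exact tsum_congr fun x => by simp only [sub_apply]; ring

/-! ## §2 The junction theorem -/

/-- **THE (A)↔(B) JUNCTION.**  From `MomentBounds6 G r a`: thresholds `β₀`, `ℓ₀ > 0` such that for EVERY coupling
sequence `β_k ≥ β₀` with `0 < a(β_k) ≤ 1/24`, `a(β_k) ≤ ℓ₀`, EVERY choice of thermodynamic limit states
`μ_k ∈ oddTorusLimitPoints r (β_k)` and EVERY growth demand `g : ℕ → ℕ`, there are torus sides `L_k` with
`g k ≤ L_k`, `14 ≤ L_k`, `a(β_k)⁻² ≤ L_k`, each `2L_k+1` one of `μ_k`'s own approximating odd tori, such that for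
every `n ≥ 2`, valid string `q` and `F ∈ ⁰𝒮ₙ`:
`latticeDistStr r.ρ β_k L_k a(β_k) (planes q) (means) F − Σ'ₓ W_{μ_k}(q,x)·F(a(β_k)·x) → 0`.
(Step 5 per test function on a countable dense subset of each `⁰𝒮ₙ`, diagonal selection, equicontinuity from the
two a-uniform bounds.) [folklore] -/
theorem exists_torusSides_approximating (r : LatticeRep G) {a : ℝ → ℝ} (hMB : MomentBounds6 G r a) :
    ∃ (β₀ ℓ₀ : ℝ), 0 < ℓ₀ ∧
      ∀ (β : ℕ → ℝ), (∀ k, β₀ ≤ β k) → (∀ k, 0 < a (β k)) → (∀ k, a (β k) ≤ 1 / 24) → (∀ k, a (β k) ≤ ℓ₀) →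
      ∀ (μ : ℕ → Measure (LGConfig 4 G)), (∀ k, μ k ∈ oddTorusLimitPoints r (β k)) →
      ∀ g : ℕ → ℕ, ∃ L : ℕ → ℕ, (∀ k, g k ≤ L k) ∧ (∀ k, 14 ≤ L k ∧ (a (β k))⁻¹ * (a (β k))⁻¹ ≤ (L k : ℝ)) ∧
        (∀ k, ∃ S : ℕ → ℕ, StrictMono S ∧ IsInfiniteVolumeLimitAlong (d := 4) r.ρ (β k) (fun j => 2 * S j) (μ k) ∧
          L k ∈ Set.range S) ∧
        ∀ n : ℕ, 2 ≤ n → ∀ q : Fin n → Fin 4 × Fin 4, (∀ i, (q i).1 < (q i).2) →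
          ∀ F : 𝓢((Fin n → EuclideanSpace ℝ (Fin 4)), ℂ), IsOffDiagonal F →
            Tendsto (fun k => latticeDistStr r.ρ (β k) (L k) (a (β k)) (fun i U => plaquetteObs r.ρ 0 (q i).1 (q i).2 U)
                (fun i => wilsonTorusMean r.ρ (β k) (L k) (fun U => plaquetteObs r.ρ 0 (q i).1 (q i).2 U)) F -
              ∑' x : Fin n → Site 4,
                (((∫ U, ∏ i, (plane G r (q i) (x i) U - ∫ V, plane G r (q i) (x i) V ∂(μ k)) ∂(μ k) : ℝ) : ℂ)) *
                  F (fun l => a (β k) • siteToE (x l))) atTop (𝓝 0) := by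
  classical
  -- constants: infinite-volume side (step 2) and torus side (the spine)
  obtain ⟨C, β₄, ℓ₄, hℓ, hC, Hcol⟩ := hMB
  obtain ⟨β₄', ℓ₄', KT, hℓ', hKT, HT⟩ := norm_latticeDistStr_le_of_momentBounds6 r ⟨C, β₄, ℓ₄, hℓ, hC, Hcol⟩
  obtain ⟨Cp, hCp⟩ := exists_abs_plane_le (G := G) r
  have hCp0 : 0 ≤ Cp := le_trans (abs_nonneg _) (hCp (0, 1) 0 (fun _ => 1))
  set KI : ℝ := ((Cp + Cp) * 4 ^ 4 * 5 ^ 6 + (Cp + Cp) * 2 ^ 6 * (10 + 2 * 6) ^ 4 +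
      16 * C * 2 ^ 6 * (2 / ℓ₄ + 48) ^ 4) * 2 ^ 6 * (81 * ∑' m : ℕ, (((m : ℝ) + 1) ^ 2)⁻¹) with hKI
  have hKI0 : 0 ≤ KI := by
    have : 0 ≤ ∑' m : ℕ, (((m : ℝ) + 1) ^ 2)⁻¹ := tsum_nonneg fun m => by positivity
    positivity
  refine ⟨max β₄ β₄', min ℓ₄ ℓ₄', lt_min hℓ hℓ', ?_⟩
  intro β hβ ha ha24 haℓ μ hμ g
  have hβ₁ : ∀ k, β₄ ≤ β k := fun k => le_trans (le_max_left _ _) (hβ k)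
  have hβ₂ : ∀ k, β₄' ≤ β k := fun k => le_trans (le_max_right _ _) (hβ k)
  have hℓ₁ : ∀ k, a (β k) ≤ ℓ₄ := fun k => (haℓ k).trans (min_le_left _ _)
  have hℓ₂ : ∀ k, a (β k) ≤ ℓ₄' := fun k => (haℓ k).trans (min_le_right _ _)
  have ha1 : ∀ k, a (β k) ≤ 1 := fun k => (ha24 k).trans (by norm_num)
  have hsa : ∀ k, (0 : ℝ) * a (β k) ≤ 1 / 4 := fun k => by simp
  haveI : ∀ k, IsProbabilityMeasure (μ k) := fun k => by
    obtain ⟨S, -, hlim⟩ := hμ k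
    exact hlim.1
  -- the defining odd-torus sequences of the states
  choose S hS hlim using hμ
  -- countable dense subsets of the `⁰𝒮ₙ`
  have hD := fun n : ℕ => schwartz_exists_countable_seminorm_dense (X := Fin n → EuclideanSpace ℝ (Fin 4)) (10 * n)
    {F : 𝓢((Fin n → EuclideanSpace ℝ (Fin 4)), ℂ) | IsOffDiagonal F}
  choose D hDA hDc hDd using hD
  haveI : ∀ n, Countable (D n) := fun n => (hDc n).to_subtype
  -- the countable family of (arity, string, dense test function) and the diagonal selection
  let ι := Σ n : ℕ, (Fin n → Fin 4 × Fin 4) × (D n)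
  let u : ℕ → ι → ℕ → ℂ := fun k i m =>
    latticeDistStr r.ρ (β k) (S k m) (a (β k)) (fun l U => plaquetteObs r.ρ 0 (i.2.1 l).1 (i.2.1 l).2 U)
      (fun l => wilsonTorusMean r.ρ (β k) (S k m) (fun U => plaquetteObs r.ρ 0 (i.2.1 l).1 (i.2.1 l).2 U)) i.2.2.1
  let c : ℕ → ι → ℂ := fun k i => ∑' x : Fin i.1 → Site 4,
    (((∫ U, ∏ l, (plane G r (i.2.1 l) (x l) U - ∫ V, plane G r (i.2.1 l) (x l) V ∂(μ k)) ∂(μ k) : ℝ) : ℂ)) *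
      (i.2.2.1 : 𝓢((Fin i.1 → EuclideanSpace ℝ (Fin 4)), ℂ)) (fun l => a (β k) • siteToE (x l))
  have hu : ∀ k i, Tendsto (fun m => u k i m) atTop (𝓝 (c k i)) := fun k i =>
    tendsto_latticeDistStr_tsum r (hS k) (hlim k) (ha k) (ha1 k) i.2.1 i.2.2.1
  -- growth demand including the thresholds of the torus bound
  obtain ⟨Ld, hLdg, hLd⟩ := exists_growth_diagonal u c hu
    (fun k => max (g k) (max 14 ⌈(a (β k))⁻¹ * (a (β k))⁻¹⌉₊))
  refine ⟨fun k => S k (Ld k), fun k => ?_, fun k => ⟨?_, ?_⟩, fun k => ⟨S k, hS k, hlim k, ⟨Ld k, rfl⟩⟩, ?_⟩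
  · exact le_trans (le_trans (le_max_left _ _) (hLdg k)) ((hS k).id_le _)
  · exact le_trans (le_trans (le_trans (le_max_left _ _) (le_max_right _ _)) (hLdg k)) ((hS k).id_le _)
  · have h1 : ((⌈(a (β k))⁻¹ * (a (β k))⁻¹⌉₊ : ℕ) : ℝ) ≤ S k (Ld k) := by
      exact_mod_cast le_trans (le_trans (le_trans (le_max_right _ _) (le_max_right _ _)) (hLdg k)) ((hS k).id_le _)
    exact (Nat.le_ceil _).trans h1
  intro n hn q hq F hF
  have hL14 : ∀ k, 14 ≤ S k (Ld k) := fun k =>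
    le_trans (le_trans (le_trans (le_max_left _ _) (le_max_right _ _)) (hLdg k)) ((hS k).id_le _)
  have hLa : ∀ k, (a (β k))⁻¹ * (a (β k))⁻¹ ≤ (S k (Ld k) : ℝ) := fun k => by
    have h1 : ((⌈(a (β k))⁻¹ * (a (β k))⁻¹⌉₊ : ℕ) : ℝ) ≤ S k (Ld k) := by
      exact_mod_cast le_trans (le_trans (le_trans (le_max_right _ _) (le_max_right _ _)) (hLdg k)) ((hS k).id_le _)
    exact (Nat.le_ceil _).trans h1
  -- shorthand for the two functionals at level `k`
  set T : ℕ → 𝓢((Fin n → EuclideanSpace ℝ (Fin 4)), ℂ) → ℂ := fun k F' =>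
    latticeDistStr r.ρ (β k) (S k (Ld k)) (a (β k)) (fun i U => plaquetteObs r.ρ 0 (q i).1 (q i).2 U)
      (fun i => wilsonTorusMean r.ρ (β k) (S k (Ld k)) (fun U => plaquetteObs r.ρ 0 (q i).1 (q i).2 U)) F' with hTdef
  set W : ℕ → (Fin n → Site 4) → ℝ := fun k x =>
    ∫ U, ∏ i, (plane G r (q i) (x i) U - ∫ V, plane G r (q i) (x i) V ∂(μ k)) ∂(μ k) with hWdef
  set Λ : ℕ → 𝓢((Fin n → EuclideanSpace ℝ (Fin 4)), ℂ) → ℂ := fun k F' =>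
    ∑' x : Fin n → Site 4, ((W k x : ℝ) : ℂ) * F' (fun l => a (β k) • siteToE (x l)) with hΛdef
  have hWsup : ∀ k x, |W k x| ≤ (Cp + Cp) ^ n := fun k x => abs_infVolWeight_le r hCp (μ k) q x
  have hWcol : ∀ k (x : Fin n → Site 4) (R : ℕ), 1 ≤ R → (R : ℝ) * a (β k) ≤ ℓ₄ →
      (∀ i j : Fin n, i ≠ j → ∃ m : Fin 4, (2 * (R : ℤ) + 4) ≤ |x i m - x j m|) →
      |W k x| ≤ (C / (R : ℝ) ^ 4) ^ n := fun k x R hR hRa hsep =>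
    momentBounds6_oddTorusLimitPoints r Hcol (hβ₁ k) ⟨S k, hS k, hlim k⟩ q x R hq hR hRa hsep
  have hy0 : ∀ k (x : Fin n → Site 4) l, ‖(fun l => a (β k) • siteToE (x l)) l - a (β k) • siteToE (x l)‖ ≤
      0 * a (β k) := fun k x l => by simp
  have hy6 : ∀ k (x : Fin n → Site 4) l, ‖(fun l => a (β k) • siteToE (x l)) l - a (β k) • siteToE (x l)‖ ≤
      6 * a (β k) := fun k x l => by rw [sub_self, norm_zero]; exact mul_nonneg (by norm_num) (ha k).le
  -- the two a-uniform bounds on `⁰𝒮ₙ`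
  have hTb : ∀ k (F' : 𝓢((Fin n → EuclideanSpace ℝ (Fin 4)), ℂ)), IsOffDiagonal F' →
      ‖T k F'‖ ≤ 5 * KT ^ n * schwartzNorm (10 * n) F' := fun k F' hF' =>
    HT (β k) (hβ₂ k) (ha k) (ha24 k) (hℓ₂ k) (S k (Ld k)) (hL14 k) (hLa k) n hn q hq F' hF'
  have hΛb : ∀ k (F' : 𝓢((Fin n → EuclideanSpace ℝ (Fin 4)), ℂ)), IsOffDiagonal F' →
      ‖Λ k F'‖ ≤ 5 * KI ^ n * schwartzNorm (10 * n) F' := fun k F' hF' =>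
    norm_tsum_weight_mul_le hℓ hC (by positivity : 0 ≤ Cp + Cp) (W k) (hWsup k) (hWcol k) (ha k) (ha1 k)
      (hℓ₁ k) hn (by norm_num) le_rfl (by linarith [ha24 k]) F' hF' _ (hy6 k)
  -- linearity
  have hTsub : ∀ k (F' F'' : 𝓢((Fin n → EuclideanSpace ℝ (Fin 4)), ℂ)), T k (F' - F'') = T k F' - T k F'' :=
    fun k F' F'' => by simp only [hTdef, map_sub]
  have hΛsub : ∀ k (F' F'' : 𝓢((Fin n → EuclideanSpace ℝ (Fin 4)), ℂ)), Λ k (F' - F'') = Λ k F' - Λ k F'' :=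
    fun k F' F'' => tsum_weight_mul_sub (ha k) (ha1 k) (hsa k) (pow_nonneg (by positivity) n) (W k) (hWsup k) _
      (hy0 k) F' F''
  -- convergence on the dense set, then everywhere on `⁰𝒮ₙ` by `ε/3`
  have hdense : ∀ d ∈ D n, Tendsto (fun k => T k d - Λ k d) atTop (𝓝 0) := fun d hd =>
    tendsto_sub_diagonal hLd ⟨n, q, ⟨d, hd⟩⟩
  rw [NormedAddGroup.tendsto_nhds_zero]
  intro ε hε
  have hden : 0 < 5 * KT ^ n + 5 * KI ^ n + 1 := by positivity
  obtain ⟨d, hd, hdε⟩ := hDd n F hF (ε / (2 * (5 * KT ^ n + 5 * KI ^ n + 1))) (by positivity)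
  have hdD : IsOffDiagonal d := hDA n hd
  have hsmall := (NormedAddGroup.tendsto_nhds_zero.1 (hdense d hd)) (ε / 2) (by positivity)
  filter_upwards [hsmall] with k hk
  have h1 : T k F - Λ k F = (T k (F - d) - Λ k (F - d)) + (T k d - Λ k d) := by
    rw [hTsub, hΛsub]; ring
  rw [h1]
  have h2 : ‖T k (F - d) - Λ k (F - d)‖ ≤ (5 * KT ^ n + 5 * KI ^ n) * schwartzNorm (10 * n) (F - d) := by
    calc _ ≤ ‖T k (F - d)‖ + ‖Λ k (F - d)‖ := norm_sub_le _ _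
      _ ≤ 5 * KT ^ n * schwartzNorm (10 * n) (F - d) + 5 * KI ^ n * schwartzNorm (10 * n) (F - d) :=
          add_le_add (hTb k _ (hF.sub hdD)) (hΛb k _ (hF.sub hdD))
      _ = _ := by ring
  have h3 : (5 * KT ^ n + 5 * KI ^ n) * schwartzNorm (10 * n) (F - d) < ε / 2 := by
    have hq' : (5 * KT ^ n + 5 * KI ^ n) * schwartzNorm (10 * n) (F - d) ≤
        (5 * KT ^ n + 5 * KI ^ n + 1) * schwartzNorm (10 * n) (F - d) :=
      mul_le_mul_of_nonneg_right (by linarith) (schwartzNorm_nonneg _ _)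
    have hq'' : (5 * KT ^ n + 5 * KI ^ n + 1) * schwartzNorm (10 * n) (F - d) <
        (5 * KT ^ n + 5 * KI ^ n + 1) * (ε / (2 * (5 * KT ^ n + 5 * KI ^ n + 1))) :=
      mul_lt_mul_of_pos_left hdε hden
    have hq''' : (5 * KT ^ n + 5 * KI ^ n + 1) * (ε / (2 * (5 * KT ^ n + 5 * KI ^ n + 1))) = ε / 2 := by
      field_simp
    linarith
  calc ‖T k (F - d) - Λ k (F - d) + (T k d - Λ k d)‖
      ≤ ‖T k (F - d) - Λ k (F - d)‖ + ‖T k d - Λ k d‖ := norm_add_le _ _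
    _ < ε / 2 + ε / 2 := add_lt_add (lt_of_le_of_lt h2 h3) hk
    _ = ε := by ring

end Summit.QuantumFields.YangMills.Theorems.InfiniteVolume

end
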